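import Summits.AnomalousDissipation.AnomalousDissipation.Theorems.DenseLoudDesignerForces.Negative.PowerBudget

/-!
# `DenseLoudLerayHopfForces` (stmt-AnomalousDissipation-1149): objects

Definitions file (D-0016 `Theorems/<RouteSlug>Defs`) for the support item `DenseLoudLerayHopfForces` of route `BaireTransfer`:
the LERAY–HOPF LOUD SETS `lhLoudSet S E ε j` — verbatim the set-builder of the item (LH-windows, i.e. open non-empty `U`
with `U ⊆ closure (lhLoudSet S E ε j)` for every `j`, are kept UNBUNDLED) — over the designer force `force S c` of the sibling crux's certified negative files (same term) — the item unfolded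
through them (`denseLoudLerayHopfForces_iff`, `Iff.rfl`), the inclusion `LOUD_j ⊆ LHLOUD_j` (a periodic classical witness of the
crux is a Leray–Hopf witness from its time-zero slice, `IsClassicalNSSolutionOn.isGlobalLerayHopf`), and the bookkeeping facts
`f_c ∈ L²`, `∫ f_c = 0`.  Companion proof files: `…Reductions` (necessity 1143 ⇒ 1149, Baire transfer at the Leray–Hopf level),
`…Anatomy` (kill shape, power shell), `…Momentum` (momentum budget, window bounds).  Nothing here closes an item.
-/

noncomputable section

-- `Summit.<Summit>.<Problem>` is the tree's mandated summit-side namespace (CONVENTIONS §2); for this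
-- single-conjunct summit the two coincide, so the duplicate is deliberate.
set_option linter.dupNamespace false

namespace Summit.AnomalousDissipation.AnomalousDissipation.Theorems.DenseLoudLerayHopfForces

open scoped BigOperators Topology ENNReal InnerProductSpace
open Filter Set MeasureTheory UnitAddTorus
open Literature.Analysis.FunctionSpaces Literature.Analysis.FluidPDE
open Summit.AnomalousDissipation.AnomalousDissipation.Theses.BaireTransfer
open Summit.AnomalousDissipation.AnomalousDissipation.Theorems.DenseLoudDesignerForces.Negative

/-! ## §0 The objects of the item -/

/-- The LERAY–HOPF LOUD SET `LHLOUD_j(S,E,ε)`: coefficient vectors `c ∈ P_S` carrying, at SOME viscosity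
`ν ∈ (0, 1/(j+1))`, a global Leray–Hopf solution `u` of `NS_ν` on `T³` forced by the steady designer force
`f_c = force S c`, from some datum `u₀`, with mean energy `≤ E` and mean dissipation `≥ ε` (verbatim the
set-builder of the item). -/
def lhLoudSet (S : Finset (Fin 3 → ℤ)) (E ε : ℝ) (j : ℕ) : Set (↥S → (EuclideanSpace ℂ (Fin 3))) :=
  {c : ↥S → (EuclideanSpace ℂ (Fin 3)) | ∃ ν : ℝ, 0 < ν ∧ ν < 1 / ((j : ℝ) + 1) ∧
    ∃ (u₀ : (UnitAddTorus (Fin 3)) → (EuclideanSpace ℝ (Fin 3)))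
      (u : ℝ → (UnitAddTorus (Fin 3)) → (EuclideanSpace ℝ (Fin 3))),
      Torus.IsGlobalLerayHopf ν (fun _ => force S c) u₀ u ∧ meanEnergy u ≤ E ∧ ε ≤ meanDissipation ν u}

/-- The item, unfolded through `lhLoudSet`/`force` (definitional). -/
theorem denseLoudLerayHopfForces_iff :
    DenseLoudLerayHopfForces ↔
      ∀ S₀ : Finset (Fin 3 → ℤ), ∃ S : Finset (Fin 3 → ℤ), S₀ ⊆ S ∧ ∃ (E ε : ℝ), 0 < ε ∧
        ∃ U : Set (↥S → (EuclideanSpace ℂ (Fin 3))), IsOpen U ∧ U.Nonempty ∧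
          ∀ j : ℕ, U ⊆ closure (lhLoudSet S E ε j) :=
  Iff.rfl

/-! ## Periodic classical witnesses are Leray–Hopf witnesses -/

/-- `LOUD_j(S,E,ε) ⊆ LHLOUD_j(S,E,ε)`: a `τ`-periodic classical witness `(u, p)` of the crux is a global
Leray–Hopf witness of the item from its time-zero slice `u 0` (Robinson–Rodrigo–Sadowski 2016, Thm. 6.5, in the
tree as `IsClassicalNSSolutionOn.isGlobalLerayHopf`); the budgets are the same functionals. -/
theorem loudSet_subset_lhLoudSet (S : Finset (Fin 3 → ℤ)) (E ε : ℝ) (j : ℕ) :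
    loudSet S E ε j ⊆ lhLoudSet S E ε j := by
  rintro c ⟨ν, hν, hνj, τ, u, p, -, hsol, -, hEu, hεu⟩
  exact ⟨ν, hν, hνj, u 0, u, hsol.isGlobalLerayHopf, hEu, hεu⟩

/-- In a window of the crux every level's Leray–Hopf loud set is dense (an "LH-window" of the item: an open non-empty
`U` with `U ⊆ closure (LHLOUD_j)` for all `j`; kept unbundled). -/
theorem subset_closure_lhLoudSet_of_isWindow {S : Finset (Fin 3 → ℤ)} {E ε : ℝ}
    {U : Set (↥S → (EuclideanSpace ℂ (Fin 3)))} (h : IsWindow S E ε U) (j : ℕ) :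
    U ⊆ closure (lhLoudSet S E ε j) :=
  (h.2.2 j).trans (closure_mono (loudSet_subset_lhLoudSet S E ε j))

/-! ## Bookkeeping: `f_c ∈ L²`, `∫ f_c = 0` -/

/-- `f_c ∈ L²(T³)`. -/
theorem memLp_force (S : Finset (Fin 3 → ℤ)) (c : ↥S → (EuclideanSpace ℂ (Fin 3))) :
    MemLp (force S c) 2 volume :=
  (isSmooth_force S c).memLp 2

-- pattern from Theorems/BaireTransferRobustLoudUpgradeStubCensusInterior.lean (`hasZeroMean_force`, same term)
/-- `f_c` has zero mean: the Fourier mode `0` of `trigPoly S (k ↦ P_k ĉ_k)` is `lerayCoeff 0 _ = 0`, and the real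
part commutes with the integral. -/
theorem hasZeroMean_force (S : Finset (Fin 3 → ℤ)) (c : ↥S → (EuclideanSpace ℂ (Fin 3))) :
    Torus.HasZeroMean (force S c) := by
  set g : (Fin 3 → ℤ) → EuclideanSpace ℂ (Fin 3) := fun k => Torus.lerayCoeff k (Torus.coeffExt S c k) with hg
  show ∫ x, EuclideanSpace.realPart (Torus.trigPoly S g x) = 0
  rw [EuclideanSpace.realPart.integral_comp_comm (Torus.continuous_trigPoly S g).integrable_unitAddTorus]
  have h : ∫ x, Torus.trigPoly S g x = 0 := by
    simp_rw [Torus.trigPoly_apply]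
    rw [integral_finsetSum S (f := fun k x => UnitAddTorus.mFourier k x • g k) fun k _ =>
      ((UnitAddTorus.mFourier k).continuous.smul continuous_const).integrable_unitAddTorus]
    refine Finset.sum_eq_zero fun k _ => ?_
    rw [integral_smul_const, Torus.integral_mFourier]
    by_cases hk : k = 0
    · subst hk; simp [hg]
    · simp [hk]
  rw [h, map_zero]

end Summit.AnomalousDissipation.AnomalousDissipation.Theorems.DenseLoudLerayHopfForces

end
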